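import Literature.MathematicalPhysics.QuantumFieldTheory.Balaban1983to89.GibbsMeasureWilsonDictionary
import Summits.QuantumFields.YangMills.Theorems.UnitScaleGibbsThinRectanglePerimeter
import HarnessLib

/-!
# (THIN-RECT) read on Bałaban's finest torus: thin ladders have perimeter-size defect under `gibbsMeasure P β`

Cell `ym3-torus` (HUMAN RULING D-0037, rung R3), width seat `ym3-torus-px5` gen 10; FILE 2 of (THIN-RECT).  The host-carrier
theorem `UnitScaleGibbsThinRectanglePerimeter.one_sub_wilsonExpectation_thin_le` (`1 − ⟨W_{n×m}⟩ ≤ (4n − 3)(1 − ⟨W_{1×m}⟩)`,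
reflection positivity) transported to the cell's lattice Yang–Mills measure `T4GenFunBounds.gibbsMeasure P β` on
`GaugeField P 0 SU(N)` through `GibbsMeasureWilsonDictionary.integral_gibbsMeasure_eq_integral_wilsonMeasure`
(`gibbsMeasure P β` = `wilsonMeasure (fundamentalRep (Fin N)) (β/N)` along `ofConfig`; `reTr g = Re tr g / N`,
`dist1 g = |g − 1|` for `SU(N)`): for `β ≥ 0`, a direction `j ≠ 0` of `T^{(0)}`, `1 ≤ n`, `2n + 4 ≤ P.sitesPerDir 0`, every width `m`
and base point `x`,

* `gibbs_integral_one_sub_reTr_thinRect_le`: `∫ (1 − Re tr U(x; n×m)) dμ_β ≤ (4n − 3) ∫ (1 − Re tr U(0; 1×m)) dμ_β`;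
* `gibbs_integral_dist1_sq_thinRect_le`: `∫ |U(x; n×m) − 1|² dμ_β ≤ 2N(4n − 3) ∫ (1 − Re tr U(0; 1×m)) dμ_β`.

Rectangles are the host tree's `rectangleHolonomy` of the relabelled configuration `toConfig U` (`n` steps in the time direction
`0`, `m` steps in direction `j`).  Everything here is proved; no definitions.
-/

open MeasureTheory
open scoped Matrix.Norms.L2Operator

namespace Summit.QuantumFields.YangMills.Theorems.UnitScaleGibbsThinRectanglePerimeterGibbs

open Literature.MathematicalPhysics.QuantumFieldTheory
open Literature.MathematicalPhysics.QuantumFieldTheory.Balaban1983to89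
open Literature.MathematicalPhysics.QuantumLattice (fundamentalRep continuous_fundamentalRep fundamentalRep_mem_unitaryGroup)
open Summit.QuantumFields.YangMills.Theorems.UnitScaleGibbsThinRectanglePerimeter

noncomputable section

variable {N : ℕ} [NeZero N]

/-- For `SU(N)` the cell's normalised real trace IS the host Wilson loop observable of the fundamental representation:
`reTr U(x; R×T) = W_{R×T}(x)`. [folklore] -/
theorem reTr_rectangleHolonomy_eq_wilsonLoop {d L : ℕ} (V : GaugeConfig d L (Matrix.specialUnitaryGroup (Fin N) ℂ))
    (x : Site d L) (i j : Fin d) (R T : ℕ) :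
    reTr (rectangleHolonomy V x i j R T) = wilsonLoop (fundamentalRep (Fin N)) x i j R T V := by
  rw [wilsonLoop_eq_nReTr]
  rfl

/-- For `SU(N)` the cell's `dist1` IS the operator-norm distance to `1` in the fundamental representation:
`dist1 U(x; R×T) = |ρ(U(x; R×T)) − 1|`. [folklore] -/
theorem dist1_rectangleHolonomy_eq {d L : ℕ} (V : GaugeConfig d L (Matrix.specialUnitaryGroup (Fin N) ℂ))
    (x : Site d L) (i j : Fin d) (R T : ℕ) :
    dist1 (rectangleHolonomy V x i j R T) = ‖fundamentalRep (Fin N) (rectangleHolonomy V x i j R T) - 1‖ := rfl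

variable (P : Params)

/-- **(THIN-RECT) on Bałaban's `T^{(0)}`, trace form**: for `β ≥ 0`, `j ≠ 0`, `1 ≤ n`, `2n + 4 ≤ P.sitesPerDir 0`, every width `m`
and base point `x`, `∫ (1 − Re tr U(x; n×m)) d(gibbsMeasure P β) ≤ (4n − 3)·∫ (1 − Re tr U(0; 1×m)) d(gibbsMeasure P β)` (dictionary to
`wilsonMeasure (fundamentalRep (Fin N)) (β/N)` + `one_sub_wilsonExpectation_thin_le_base`).
[cite: SeilerLNP1982, §2 (static quark potential and string tension from reflection positivity)] -/
theorem gibbs_integral_one_sub_reTr_thinRect_le {β : ℝ} (hβ : 0 ≤ β) {j : Fin P.d} (hj : j ≠ 0) {n : ℕ}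
    (hn1 : 1 ≤ n) (hn : 2 * n + 4 ≤ P.sitesPerDir 0) (m : ℕ) (x : Site P.d (P.sitesPerDir 0)) :
    ∫ U : GaugeField P 0 (Matrix.specialUnitaryGroup (Fin N) ℂ),
        (1 - reTr (rectangleHolonomy (toConfig U) x 0 j n m)) ∂(T4GenFunBounds.gibbsMeasure P β) ≤
      (4 * n - 3 : ℝ) *
        ∫ U : GaugeField P 0 (Matrix.specialUnitaryGroup (Fin N) ℂ),
          (1 - reTr (rectangleHolonomy (toConfig U) (0 : Site P.d (P.sitesPerDir 0)) 0 j 1 m))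
            ∂(T4GenFunBounds.gibbsMeasure P β) := by
  haveI : Fact (1 < P.sitesPerDir 0) := ⟨P.one_lt_sitesPerDir 0⟩
  have hρc := continuous_fundamentalRep (Fin N)
  have hρu : ∀ g : Matrix.specialUnitaryGroup (Fin N) ℂ, fundamentalRep (Fin N) g ∈ Matrix.unitaryGroup (Fin N) ℂ :=
    fun g => fundamentalRep_mem_unitaryGroup g
  have hβ' : 0 ≤ β / N := div_nonneg hβ (Nat.cast_nonneg _)
  rw [GibbsMeasureWilsonDictionary.integral_gibbsMeasure_eq_integral_wilsonMeasure P hβ,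
    GibbsMeasureWilsonDictionary.integral_gibbsMeasure_eq_integral_wilsonMeasure P hβ]
  simp only [toConfig_ofConfig, reTr_rectangleHolonomy_eq_wilsonLoop]
  rw [← one_sub_wilsonExpectation_eq (fundamentalRep (Fin N)) hρc hρu,
    ← one_sub_wilsonExpectation_eq (fundamentalRep (Fin N)) hρc hρu]
  exact one_sub_wilsonExpectation_thin_le_base (fundamentalRep (Fin N)) hρc hρu hβ' hj hn1 hn m x

/-- **(THIN-RECT) on Bałaban's `T^{(0)}`, `dist1` form**: `∫ |U(x; n×m) − 1|² d(gibbsMeasure P β) ≤ 2N(4n − 3)·∫ (1 − Re tr U(0; 1×m))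
d(gibbsMeasure P β)` — the second moment of the distance to `1` of every thin ladder holonomy is of PERIMETER size in the mean
`1 × m` defect. [cite: SeilerLNP1982, §2 (static quark potential and string tension from reflection positivity)] -/
theorem gibbs_integral_dist1_sq_thinRect_le {β : ℝ} (hβ : 0 ≤ β) {j : Fin P.d} (hj : j ≠ 0) {n : ℕ}
    (hn1 : 1 ≤ n) (hn : 2 * n + 4 ≤ P.sitesPerDir 0) (m : ℕ) (x : Site P.d (P.sitesPerDir 0)) :
    ∫ U : GaugeField P 0 (Matrix.specialUnitaryGroup (Fin N) ℂ),
        dist1 (rectangleHolonomy (toConfig U) x 0 j n m) ^ 2 ∂(T4GenFunBounds.gibbsMeasure P β) ≤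
      2 * N * (4 * n - 3 : ℝ) *
        ∫ U : GaugeField P 0 (Matrix.specialUnitaryGroup (Fin N) ℂ),
          (1 - reTr (rectangleHolonomy (toConfig U) (0 : Site P.d (P.sitesPerDir 0)) 0 j 1 m))
            ∂(T4GenFunBounds.gibbsMeasure P β) := by
  haveI : Fact (1 < P.sitesPerDir 0) := ⟨P.one_lt_sitesPerDir 0⟩
  have hρc := continuous_fundamentalRep (Fin N)
  have hρu : ∀ g : Matrix.specialUnitaryGroup (Fin N) ℂ, fundamentalRep (Fin N) g ∈ Matrix.unitaryGroup (Fin N) ℂ :=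
    fun g => fundamentalRep_mem_unitaryGroup g
  have hβ' : 0 ≤ β / N := div_nonneg hβ (Nat.cast_nonneg _)
  rw [GibbsMeasureWilsonDictionary.integral_gibbsMeasure_eq_integral_wilsonMeasure P hβ,
    GibbsMeasureWilsonDictionary.integral_gibbsMeasure_eq_integral_wilsonMeasure P hβ]
  simp only [toConfig_ofConfig, reTr_rectangleHolonomy_eq_wilsonLoop, dist1_rectangleHolonomy_eq]
  rw [← one_sub_wilsonExpectation_eq (fundamentalRep (Fin N)) hρc hρu]
  exact integral_opNormSq_thinRect_sub_one_le (fundamentalRep (Fin N)) hρc hρu hβ' hj hn1 hn m x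

end

end Summit.QuantumFields.YangMills.Theorems.UnitScaleGibbsThinRectanglePerimeterGibbs
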